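import Summits.QuantumFields.YangMills.Theorems.BalabanUVNodesN07LocalLettersCoreGuarded
import HarnessLib

/-!
# N07 [B11] (= [15] = [Balaban1985Variational]) Sect. F, road R0′, S6 HEAD: **LEVEL RAISING FOR THE SPLIT CLAUSE** — print's «take a cube □ intersecting Ω_j
# but NOT Ω_{j+1}» (p. 300) as a REDUCTION of the guarded per-datum token `DatumGaugeSplitTopStepCoreG` to its CLEAN datums

Cell `pub-ymgap`, seat `pub-ymgap-dag-n07-e` g22 (node N07, FAN-OUT §N07 row s3; lane owner of the K0 road), CLAIM-56 ∕ INTENT-56 (cell bus, LOCATED-INWARD-DATUM).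
`--kind proof --supports stmt-QuantumFields-20541 --as helper`; count-neutral; def-free.  [15] = [Balaban1985Variational], [6] = [Balaban1985RegularSpaces].

THE LOCATED POINT.  The S6 token `DatumGaugeSplitTopStepCoreG F N Sup Mc ρ Adm …` (dag-n07-w4 g3, p624743) asks the split clause `LocalGaugeSplitOn (π '' 𝔔(j,a)) η_j (κε_j)
(Cδ_j + θε_j + Qε_j²) U` (`𝔔(j,a) = box L (cornerP Mc ρ a) (sideP Mc ρ) j`, the print box of the grid cube `a` at level `j`) at EVERY datum `(j, a)`, `1 ≤ j ≤ k`, whose grid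
cube comes within `3` of `Ω_j`; since `Ω_{j+1} ⊆ Ω_j` this includes the INWARD datums (print box meeting `Ω_{j+1}`), where a per-cube family capped at level `j` (the
head's `cubeDomains … j`, FILE 5 p633893 :126) demotes the record's `(j+1)`-fold constraints inside `Ω_{j+1}` to `j`-fold ones whose «data» is the minimiser's own
unprescribed `j`-average — next to the core and not `δ`-small, so the chart lane's `HCHART` is not dischargeable there inside `HBUDGET` for a general `T4Family`.
PRINT never meets the case: p. 300 «a cube □ intersecting Ω_j but not Ω_{j+1}», «□̃ ⊂ B^{j−1}(Λ_{j−1}) ∪ B^j(Λ_j)»; p. 279 (class of cubes): the datum is indexed by the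
DEEPEST level its window meets; a plaquette of `Λ_j` next to `Ω_{j+1}` is served by the level-`(j+1)` datum's outward part `□′^{(j)}` ((147)–(150), (160) «2L²ε₁»).

THE REPAIR (token UNCHANGED; no stub ∕ K-text touched) = LEVEL RAISING: the clause at an inward `(j, a)` follows from the clause at `(j+1, a⁺)` on a print box
`𝔔(j+1, a⁺) ⊇ 𝔔(j, a)` by RESTRICTION (§1 `.mono_set`) and LEVEL CONVERSION (§1 ★★ `.of_level_down`: `η_{j+1} = η_j ∕ L`, `A ↦ L⁻¹•A`; `expI`, r11's `grad`, 33b's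
`Sect2.curlA ∕ codiffCurlA` are `ξ⁻¹ ∕ ξ⁻² ∕ ξ⁻³`-homogeneous), the thresholds closing by the token's own comparabilities `ε_{j+1} ≤ 2ε_j`, `δ_{j+1} ≤ 2δ_j` (§2, `L ≥ 2`),
recursing on `k − j` (the top datum is clean); §3: for `1 ≤ Mc ≤ ρ` every level-`j` print box lies in a level-`(j+1)` print box (`gridFloor` arithmetic), `□ ⊆ 𝔔`;
§4 ★★★ THE REDUCTION: the token holds as soon as its clause holds at the CLEAN datums `(j = k) ∨ (𝔔(j,a) ∩ π⁻¹Ω_{j+1} = ∅)`, the meeting premise read on the print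
box (`∃ x ∈ 𝔔(j,a), ∃ y, π y ∈ Ω_j ∧ Within 3 x y`; the parent box need not have its CORE near `Ω_{j+1}`, hence the box form).  So the head's knit owes `hP6` ∕
`HCHART` ∕ `HBUDGET` only at clean datums (windows over the levels `{j−1, j}`; the outward meet ∕ `D″` edition of FILES 3∕5 stays as noted).

WHAT IS PROVED (sorry-free; no definition; axioms standard): §1 `LocalGaugeSplitOn.mono_set ∕ .of_level_down ∕ .of_eta_succ`, `expI_mul_inv_smul`, `grad ∕ curlA ∕
codiffCurlA_inv_smul_mul`, `Params.L_mul_eta_succ`; §2 `raise_thresholds`, ★★ `LocalGaugeSplitOn.raise`; §3 `box_subset_box_succ_of_corner`, ★ `exists_cornerP_box_subset_succ`,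
`cubeExt_side_subset_box_cornerP`; §4 ★★★ `localGaugeSplitOn_allDatums_of_clean` (generic `Params`, any `Ω`, `U`), ★★★ `datumGaugeSplitTopStepCoreG_of_clean`.
HONEST SCOPE.  Count-neutral bookkeeping (a rescaling identity, two monotonicities, integer box arithmetic, an induction on `k − j`); NO estimate of Bałaban's; nothing
of [15] ∕ [6] analysis asserted; the clause at clean datums remains the HYPOTHESIS it is in the head's knit (`hP6`, `HCHART`, `HBUDGET`); no landed statement claimed false;
the token ∕ `HalvingStepTop(Core)G` ∕ `stub_prop8StepCoP13` ∕ V20-G ∕ K0⁷ ∕ K1⁹ NOT closed; N07 ∕ N05 NOT discharged; counts unmoved (28∕28 · 5∕27); one finite 𝕋⁴ programme at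
fixed ε — the route closes the conditional finite-𝕋⁴ rung `BalabanLadder.UV` ONLY; the YM mass gap (Clay) is NOT proved; nothing continuum ∕ ℝ⁴ ∕ OS.  No `sorry`∕`def`∕
`instance`∕`notation`.  RELATED, NOT DUPLICATED (BY NAME): `LocalGaugeSplitOn` + `.of_le` (p612069), the token (p624743), 33b `Sect2.bondsDeep_mono`, def-T
`Sect2.regionOfSet_bonds∕dpairs_mono`, 36a `cornerP ∕ sideP ∕ gridFloor_le ∕ lt_gridFloor_add ∕ le_sideP ∕ box_subset_box_of_corner`, FILE 26 `cubeExt_side_eq_box`.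
References: [15] p. 279, (144) p. 300, (147)–(150) p. 301, (160) p. 303, (165)–(168) p. 304, Prop. 8 p. 304; [6] (1.2) p. 76, (1.7)–(1.9) p. 77, p. 98, (1.131) p. 99.
-/

set_option autoImplicit false
noncomputable section
open scoped BigOperators Matrix.Norms.L2Operator

namespace Summit.QuantumFields.YangMills.BalabanUVNodes.N07SplitClauseLevelRaising

open Complex (I)
open Literature.MathematicalPhysics.QuantumFieldTheory.Balaban1983to89
open Literature.MathematicalPhysics.QuantumFieldTheory.Balaban1983to89.Node00
open Literature.MathematicalPhysics.QuantumFieldTheory.Balaban1983to89.B15DeterminingSets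
open Literature.MathematicalPhysics.QuantumFieldTheory.Balaban1983to89.B12RegularSpaces111 (gaugeU expI grad)
open T4Continuum (T4Family)
open B15Eq112TorusCover (cover)
open B14DomainGeom (Pt Within)
open B14.Eq213MaximalDomains (side cubeExt)
open B8Eq131Cubes (box bLo bHi)
open Summit.QuantumFields.YangMills.BalabanUVNodes.N07LocalLettersSplitCore (LocalGaugeSplitOn)
open Summit.QuantumFields.YangMills.BalabanUVNodes.N07LocalLettersCoreGuarded (DatumGaugeSplitTopStepCoreG)

/-! ## §1  Restriction and level conversion of the split clause -/

section Clause

variable {P : Params} {N : ℕ}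

/-- **THE SPLIT CLAUSE RESTRICTS TO A SMALLER SITE SET** (`Y ⊆ Y′`; the curl-free letter is global). [cite: Balaban1985Variational, (165) p.304 (bookkeeping); Balaban1987RG1, (1.13)–(1.14) p.262] -/
theorem _root_.Summit.QuantumFields.YangMills.BalabanUVNodes.N07LocalLettersSplitCore.LocalGaugeSplitOn.mono_set {Y Y' : Set (Site P 0)} (hY : Y ⊆ Y') {ξ t t₀ : ℝ} {U : GaugeField P 0 (SU N)}
    (h : LocalGaugeSplitOn Y' ξ t t₀ U) : LocalGaugeSplitOn Y ξ t t₀ U := by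
  obtain ⟨u, A₀, G, he, hG, hA, hdA, hdA₀, h10⟩ := h
  exact ⟨u, A₀, G, fun b hb => he b (Sect2.regionOfSet_bonds_mono hY hb), hG, fun b hb => hA b (Sect2.regionOfSet_bonds_mono hY hb),
    fun q hq => hdA q (Sect2.regionOfSet_dpairs_mono hY hq), fun q hq => hdA₀ q (Sect2.regionOfSet_dpairs_mono hY hq),
    fun b hb => h10 b (Sect2.bondsDeep_mono hY hb)⟩

/-- **`e^{i(Lξ)(L⁻¹A)} = e^{iξA}`** (`L ≠ 0`). [cite: Balaban1985Variational, (152) p.301 (bookkeeping); Balaban1987RG1, (1.12) p.262] -/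
theorem expI_mul_inv_smul {L : ℝ} (hL : L ≠ 0) (ξ : ℝ) (a : MatA N) :
    expI (L * ξ) (((L : ℝ) : ℂ)⁻¹ • a) = expI ξ a := by
  unfold expI
  congr 1
  rw [smul_smul]
  congr 1
  have hL' : ((L : ℝ) : ℂ) ≠ 0 := by exact_mod_cast hL
  push_cast
  field_simp

/-- **`∇^{Lξ}(L⁻¹F) = L⁻²·∇^ξF`** (r11's `grad` is `ξ⁻¹`-homogeneous). [cite: Balaban1987RG1, (1.12) p.262 (bookkeeping)] -/
theorem grad_inv_smul_mul {L : ℝ} (hL : L ≠ 0) (ξ : ℝ) (μ : Fin P.d) (F : Site P 0 → MatA N) (x : Site P 0) :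
    grad (L * ξ) μ (fun y => ((L : ℝ) : ℂ)⁻¹ • F y) x = (((L : ℝ) : ℂ)⁻¹ * ((L : ℝ) : ℂ)⁻¹) • grad ξ μ F x := by
  have hL' : ((L : ℝ) : ℂ) ≠ 0 := by exact_mod_cast hL
  simp only [grad, ← smul_sub, smul_smul]
  congr 1
  push_cast
  rw [mul_inv]
  ring

/-- **`∂^{Lξ}(L⁻¹G) = L⁻²·∂^ξG`** (33b's `Sect2.curlA` is `ξ⁻¹`-homogeneous and linear). [cite: Balaban1985BackgroundPropagators, (3.4) p.391 (bookkeeping)] -/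
theorem curlA_inv_smul_mul {L : ℝ} (hL : L ≠ 0) (ξ : ℝ) (G : PBond P 0 → MatA N) (y : Site P 0) (ν μ : Fin P.d) :
    Sect2.curlA (L * ξ) (((L : ℝ) : ℂ)⁻¹ • G) y ν μ = (((L : ℝ) : ℂ)⁻¹ * ((L : ℝ) : ℂ)⁻¹) • Sect2.curlA ξ G y ν μ := by
  simp only [Sect2.curlA, Pi.smul_apply]
  rw [grad_inv_smul_mul hL ξ ν (fun z => G ⟨z, μ⟩) y, grad_inv_smul_mul hL ξ μ (fun z => G ⟨z, ν⟩) y, smul_sub]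

/-- **`∂^{Lξ*}∂^{Lξ}(L⁻¹A) = L⁻³·∂^{ξ*}∂^ξA`** (33b's `Sect2.codiffCurlA` is `ξ⁻²`-homogeneous and linear). [cite: Balaban1985Variational, Thm 1 (10) p.279 (bookkeeping)] -/
theorem codiffCurlA_inv_smul_mul {L : ℝ} (hL : L ≠ 0) (ξ : ℝ) (A : PBond P 0 → MatA N) (x : Site P 0) (μ : Fin P.d) :
    Sect2.codiffCurlA (L * ξ) (((L : ℝ) : ℂ)⁻¹ • A) x μ =
      (((L : ℝ) : ℂ)⁻¹ * (((L : ℝ) : ℂ)⁻¹ * ((L : ℝ) : ℂ)⁻¹)) • Sect2.codiffCurlA ξ A x μ := by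
  have hL' : ((L : ℝ) : ℂ) ≠ 0 := by exact_mod_cast hL
  simp only [Sect2.codiffCurlA, curlA_inv_smul_mul hL, ← smul_sub, smul_smul, Finset.smul_sum]
  refine Finset.sum_congr rfl fun ν _ => ?_
  congr 1
  push_cast
  rw [mul_inv]
  ring

/-- The norm of `(L⁻¹)ⁿ • v` for real `L > 0`. [folklore] -/
private theorem norm_inv_pow_smul {L : ℝ} (hL : 0 < L) (n : ℕ) (v : MatA N) :
    ‖((((L : ℝ) : ℂ)⁻¹) ^ n) • v‖ = (L⁻¹) ^ n * ‖v‖ := by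
  rw [norm_smul, norm_pow, norm_inv, Complex.norm_real, Real.norm_of_nonneg hL.le]

/-- `(L⁻¹)ⁿ·r ≤ L⁻¹·r` for `L ≥ 1`, `n ≥ 1`, `r ≥ 0`. [folklore] -/
private theorem inv_pow_mul_le {L r : ℝ} (hL : 1 ≤ L) (hr : 0 ≤ r) {n : ℕ} (hn : 1 ≤ n) :
    (L⁻¹) ^ n * r ≤ L⁻¹ * r := by
  have : (L⁻¹) ^ n ≤ (L⁻¹) ^ 1 := pow_le_pow_of_le_one (inv_nonneg.mpr (by linarith)) (inv_le_one_of_one_le₀ hL) hn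
  exact mul_le_mul_of_nonneg_right (by rwa [pow_one] at this) hr

/-- ★★ **LEVEL CONVERSION OF THE SPLIT CLAUSE** (`ξ ↦ L·ξ`, `L ≥ 1`): same gauge `u`, potential `A₀ + G ↦ L⁻¹•(A₀ + G)` (bond variables unchanged, `L⁻¹G` curl-free),
letters `‖·‖ < t∕L`, `‖∇‖ = L⁻²‖…‖ < t∕L`, `‖∇A₀‖ < t₀∕L²`, `‖∂*∂A₀‖ = L⁻³‖…‖ < t₀∕L²`; with `ξ = η_{j+1}`, `Lξ = η_j`: the passage from a level-`(j+1)` datum to the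
level-`j` letters of print's «□′_k^{(k−1)}». [cite: Balaban1985Variational, p.300, (147)–(150) p.301, (160) p.303, (165)–(168) p.304; Balaban1985RegularSpaces, (1.2) p.76, (1.7)–(1.9) p.77] -/
theorem _root_.Summit.QuantumFields.YangMills.BalabanUVNodes.N07LocalLettersSplitCore.LocalGaugeSplitOn.of_level_down {Y : Set (Site P 0)} {ξ t t₀ : ℝ} {U : GaugeField P 0 (SU N)} {L : ℝ} (hL : 1 ≤ L)
    (h : LocalGaugeSplitOn Y ξ t t₀ U) : LocalGaugeSplitOn Y (L * ξ) (t / L) (t₀ / L ^ 2) U := by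
  have hL0 : 0 < L := by linarith
  have hLne : L ≠ 0 := hL0.ne'
  obtain ⟨u, A₀, G, he, hG, hA, hdA, hdA₀, h10⟩ := h
  set c : ℂ := ((L : ℝ) : ℂ)⁻¹ with hc
  have hcn : ∀ (n : ℕ) (v : MatA N), ‖(c ^ n) • v‖ = (L⁻¹) ^ n * ‖v‖ := fun n v => by rw [hc]; exact norm_inv_pow_smul hL0 n v
  have hadd : c • A₀ + c • G = c • (A₀ + G) := (smul_add c A₀ G).symm
  refine ⟨u, c • A₀, c • G, ?_, ?_, ?_, ?_, ?_, ?_⟩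
  · -- the bond variables are unchanged
    intro b hb
    rw [he b hb, hadd, Pi.smul_apply, hc, expI_mul_inv_smul hLne]
  · -- `L⁻¹G` is curl-free at the new spacing
    intro y ν μ
    rw [hc, curlA_inv_smul_mul hLne, hG y ν μ, smul_zero]
  · -- `‖L⁻¹(A₀+G)‖ < t/L`
    intro b hb
    rw [hadd, Pi.smul_apply, show c = c ^ 1 from (pow_one c).symm, hcn, pow_one, inv_mul_eq_div]
    exact div_lt_div_of_pos_right (hA b hb) hL0
  · -- `‖∇^{Lξ}L⁻¹(A₀+G)‖ = L⁻²‖∇^ξ(A₀+G)‖ ≤ L⁻¹‖…‖ < t/L`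
    intro q hq
    have h1 : grad (L * ξ) q.2.1 (fun y => (c • A₀ + c • G) ⟨y, q.2.2⟩) q.1 = (c * c) • grad ξ q.2.1 (fun y => (A₀ + G) ⟨y, q.2.2⟩) q.1 := by
      rw [hadd]; simp only [Pi.smul_apply]; rw [hc, grad_inv_smul_mul hLne]
    rw [h1, show c * c = c ^ 2 by ring, hcn]
    calc (L⁻¹) ^ 2 * ‖grad ξ q.2.1 (fun y => (A₀ + G) ⟨y, q.2.2⟩) q.1‖
        ≤ L⁻¹ * ‖grad ξ q.2.1 (fun y => (A₀ + G) ⟨y, q.2.2⟩) q.1‖ := inv_pow_mul_le hL (norm_nonneg _) (by norm_num)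
      _ < L⁻¹ * t := mul_lt_mul_of_pos_left (hdA q hq) (inv_pos.mpr hL0)
      _ = t / L := inv_mul_eq_div _ _
  · -- `‖∇^{Lξ}L⁻¹A₀‖ = L⁻²‖∇^ξA₀‖ < t₀/L²`
    intro q hq
    have h1 : grad (L * ξ) q.2.1 (fun y => (c • A₀) ⟨y, q.2.2⟩) q.1 = (c * c) • grad ξ q.2.1 (fun y => A₀ ⟨y, q.2.2⟩) q.1 := by
      simp only [Pi.smul_apply]; rw [hc, grad_inv_smul_mul hLne]
    rw [h1, show c * c = c ^ 2 by ring, hcn, inv_pow, inv_mul_eq_div]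
    exact div_lt_div_of_pos_right (hdA₀ q hq) (by positivity)
  · -- `‖∂^{Lξ*}∂^{Lξ}L⁻¹A₀‖ = L⁻³‖…‖ ≤ L⁻²‖…‖ < t₀/L²`
    intro b hb
    rw [show c • A₀ = (((L : ℝ) : ℂ)⁻¹) • A₀ by rw [hc], codiffCurlA_inv_smul_mul hLne, ← hc, show c * (c * c) = c ^ 3 by ring, hcn]
    have hL2 : (L⁻¹) ^ 3 * ‖Sect2.codiffCurlA ξ A₀ b.src b.dir‖ ≤ (L⁻¹) ^ 2 * ‖Sect2.codiffCurlA ξ A₀ b.src b.dir‖ :=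
      mul_le_mul_of_nonneg_right (pow_le_pow_of_le_one (inv_nonneg.mpr hL0.le) (inv_le_one_of_one_le₀ hL) (by norm_num)) (norm_nonneg _)
    refine hL2.trans_lt ?_
    rw [inv_pow, inv_mul_eq_div]
    exact div_lt_div_of_pos_right (h10 b hb) (by positivity)

/-- **`L·η_{j+1} = η_j`** (`η_n = L^{−n}`). [cite: BalabanImbrieJaffe1985, (2.24) p.305 (bookkeeping)] -/
theorem Params.L_mul_eta_succ (P : Params) (j : ℕ) : (P.L : ℝ) * P.eta (j + 1) = P.eta j := by
  have hL : (P.L : ℝ) ≠ 0 := Nat.cast_ne_zero.mpr P.L_pos.ne'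
  rw [Params.eta, Params.eta, pow_succ]
  field_simp

/-- **THE SPLIT CLAUSE ONE LEVEL UP THE TOWER**: a clause at spacing `η_{j+1}` gives the clause at spacing `η_j` with thresholds `t∕L`, `t₀∕L²`.
[cite: Balaban1985Variational, p.300 («□ intersecting Ω_j but not Ω_{j+1}»), (160) p.303, (167)–(168) p.304] -/
theorem _root_.Summit.QuantumFields.YangMills.BalabanUVNodes.N07LocalLettersSplitCore.LocalGaugeSplitOn.of_eta_succ {Y : Set (Site P 0)} {t t₀ : ℝ} {U : GaugeField P 0 (SU N)} (j : ℕ)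
    (h : LocalGaugeSplitOn Y (P.eta (j + 1)) t t₀ U) : LocalGaugeSplitOn Y (P.eta j) (t / P.L) (t₀ / (P.L : ℝ) ^ 2) U := by
  have hL : (1 : ℝ) ≤ P.L := by exact_mod_cast P.L_pos
  rw [← Params.L_mul_eta_succ P j]
  exact h.of_level_down hL

end Clause

/-! ## §2  The thresholds close one level up by the comparabilities `ε_{j+1} ≤ 2ε_j`, `δ_{j+1} ≤ 2δ_j` -/

section Thresholds

/-- **THE THRESHOLD ARITHMETIC OF ONE RAISING STEP** (`L ≥ 2`, nonnegative letters, `ε′ ≤ 2ε`, `δ′ ≤ 2δ`): `κε′∕L ≤ κε` and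
`(Cδ′ + θε′ + Qε′²)∕L² ≤ Cδ + θε + Qε²`. [cite: Balaban1985Variational, (162)–(166) pp.303–304 («B₃ depends on d and L only»; bookkeeping)] -/
theorem raise_thresholds {L κ C θ Q ε ε' δ δ' : ℝ} (hL : 2 ≤ L) (hκ : 0 ≤ κ) (hC : 0 ≤ C) (hθ : 0 ≤ θ) (hQ : 0 ≤ Q)
    (hε : 0 ≤ ε) (hδ : 0 ≤ δ) (hε'0 : 0 ≤ ε') (hε' : ε' ≤ 2 * ε) (hδ' : δ' ≤ 2 * δ) :
    κ * ε' / L ≤ κ * ε ∧ (C * δ' + θ * ε' + Q * ε' ^ 2) / L ^ 2 ≤ C * δ + θ * ε + Q * ε ^ 2 := by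
  have hL0 : 0 < L := by linarith
  constructor
  · rw [div_le_iff₀ hL0]
    have hκε : 0 ≤ κ * ε := mul_nonneg hκ hε
    calc κ * ε' ≤ κ * (2 * ε) := mul_le_mul_of_nonneg_left hε' hκ
      _ = κ * ε * 2 := by ring
      _ ≤ κ * ε * L := mul_le_mul_of_nonneg_left hL hκε
  · rw [div_le_iff₀ (by positivity)]
    have h1 : C * δ' ≤ C * (2 * δ) := mul_le_mul_of_nonneg_left hδ' hC
    have h2 : θ * ε' ≤ θ * (2 * ε) := mul_le_mul_of_nonneg_left hε' hθ
    have h3 : Q * ε' ^ 2 ≤ Q * (2 * ε) ^ 2 := mul_le_mul_of_nonneg_left (pow_le_pow_left₀ hε'0 hε' 2) hQ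
    have h4 : (4 : ℝ) ≤ L ^ 2 := by nlinarith
    have h5 : 0 ≤ C * δ + θ * ε + Q * ε ^ 2 := by positivity
    nlinarith

variable {P : Params} {N : ℕ}

/-- ★★ **ONE RAISING STEP**: the clause on `Y′ ⊇ Y` at `η_{j+1}` with the token's level-`(j+1)` thresholds gives the clause on `Y` at `η_j` with the level-`j` thresholds
(restriction, level conversion, threshold arithmetic). [cite: Balaban1985Variational, p.300, (147)–(150) p.301, (160) p.303, (165)–(168) p.304] -/
theorem _root_.Summit.QuantumFields.YangMills.BalabanUVNodes.N07LocalLettersSplitCore.LocalGaugeSplitOn.raise {Y Y' : Set (Site P 0)} (hY : Y ⊆ Y') {U : GaugeField P 0 (SU N)} (hL : 2 ≤ P.L) (j : ℕ)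
    {κ C θ Q ε ε' δ δ' : ℝ} (hκ : 0 ≤ κ) (hC : 0 ≤ C) (hθ : 0 ≤ θ) (hQ : 0 ≤ Q) (hε : 0 ≤ ε) (hδ : 0 ≤ δ) (hε'0 : 0 ≤ ε')
    (hε' : ε' ≤ 2 * ε) (hδ' : δ' ≤ 2 * δ) (h : LocalGaugeSplitOn Y' (P.eta (j + 1)) (κ * ε') (C * δ' + θ * ε' + Q * ε' ^ 2) U) :
    LocalGaugeSplitOn Y (P.eta j) (κ * ε) (C * δ + θ * ε + Q * ε ^ 2) U := by
  have hL' : (2 : ℝ) ≤ P.L := by exact_mod_cast hL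
  obtain ⟨h1, h2⟩ := raise_thresholds hL' hκ hC hθ hQ hε hδ hε'0 hε' hδ'
  exact ((h.mono_set hY).of_eta_succ j).of_le h1 h2

end Thresholds

/-! ## §3  Print boxes nest one level up (`1 ≤ Mc ≤ ρ`), and the grid cube lies in its print box -/

section Boxes

variable {d : ℕ}

/-- **A LEVEL-`n` BOX INSIDE A LEVEL-`(n+1)` BOX**: `L·c′ ≤ c` and `c + S ≤ L·(c′ + S′)` coordinatewise ⇒ `box L c S n ⊆ box L c′ S′ (n+1)`.
[cite: Balaban1985RegularSpaces, p.98 («□_j is a sum of the big blocks of the lattice T_{L^{−j}}»; bookkeeping)] -/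
theorem box_subset_box_succ_of_corner (L : ℕ) {c c' : Pt d} {S S' : ℕ} (h1 : ∀ i, (L : ℤ) * c' i ≤ c i)
    (h2 : ∀ i, c i + (S : ℤ) ≤ (L : ℤ) * (c' i + (S' : ℤ))) (n : ℕ) : box L c S n ⊆ box L c' S' (n + 1) := by
  intro z hz i
  obtain ⟨hl, hu⟩ := hz i
  simp only [bLo, bHi, Nat.cast_zero, sub_zero, add_zero] at hl hu ⊢
  have hLn : (0 : ℤ) ≤ (L : ℤ) ^ n := by positivity
  have e : (L : ℤ) ^ (n + 1) = (L : ℤ) ^ n * L := pow_succ _ _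
  constructor
  · have := mul_le_mul_of_nonneg_left (h1 i) hLn
    rw [e, mul_assoc]; linarith
  · have := mul_le_mul_of_nonneg_left (h2 i) hLn
    rw [e, mul_assoc]; linarith

variable {P : Params}

/-- ★ **EVERY LEVEL-`n` PRINT BOX LIES IN A LEVEL-`(n+1)` PRINT BOX OF THE SAME LETTERS** (`1 ≤ Mc ≤ ρ`, `1 ≤ L`): with `cornerP Mc ρ a = ρ·q`, the level-`(n+1)`
index `a⁺_i := ⌊(ρ⌊q_i∕L⌋ + Mc − 1)∕Mc⌋` has print corner `ρ·⌊q_i∕L⌋` (`Mc ≤ ρ`), and `L·ρ⌊q∕L⌋ ≤ ρq`, `ρq + ρs ≤ L·(ρ⌊q∕L⌋ + ρs)` (`sideP = ρ·s`, `s ≥ 1`).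
[cite: Balaban1985Variational, (144) p.300, p.300 («□ intersecting Ω_j but not Ω_{j+1}»); Balaban1985RegularSpaces, p.98] -/
theorem exists_cornerP_box_subset_succ {Mc ρ : ℕ} (hMc : 1 ≤ Mc) (hMcρ : Mc ≤ ρ) (hL : 1 ≤ P.L) (a : Pt P.d) (n : ℕ) :
    ∃ a' : Pt P.d, box P.L (cornerP P Mc ρ a) (sideP P Mc ρ) n ⊆ box P.L (cornerP P Mc ρ a') (sideP P Mc ρ) (n + 1) := by
  have hρ0 : (0 : ℤ) < ρ := by exact_mod_cast (lt_of_lt_of_le hMc hMcρ)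
  have hMc0 : (0 : ℤ) < Mc := by exact_mod_cast hMc
  have hL0 : (0 : ℤ) < P.L := by exact_mod_cast hL
  -- the letters
  set q : Pt P.d := fun i => ((Mc : ℤ) * a i) / (ρ : ℤ) with hq
  set t : Pt P.d := fun i => q i / (P.L : ℤ) with ht
  set a' : Pt P.d := fun i => ((ρ : ℤ) * t i + (Mc : ℤ) - 1) / (Mc : ℤ) with ha'
  -- the new corner is `ρ·t`
  have hcorner : ∀ i, cornerP P Mc ρ a' i = (ρ : ℤ) * t i := by
    intro i
    have hlo : (ρ : ℤ) * t i ≤ (Mc : ℤ) * a' i := by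
      have := Int.lt_ediv_add_one_mul_self ((ρ : ℤ) * t i + (Mc : ℤ) - 1) hMc0
      simp only [ha'] at this ⊢
      nlinarith
    have hhi : (Mc : ℤ) * a' i < (ρ : ℤ) * (t i + 1) := by
      have := Int.ediv_mul_le ((ρ : ℤ) * t i + (Mc : ℤ) - 1) hMc0.ne'
      simp only [ha'] at this ⊢
      have hMcρ' : (Mc : ℤ) ≤ ρ := by exact_mod_cast hMcρ
      nlinarith
    have h1 : t i ≤ (Mc : ℤ) * a' i / (ρ : ℤ) := Int.le_ediv_of_mul_le hρ0 ((mul_comm _ _).trans_le hlo)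
    have h2 : (Mc : ℤ) * a' i / (ρ : ℤ) < t i + 1 := Int.ediv_lt_of_lt_mul hρ0 (hhi.trans_eq (mul_comm _ _))
    have h3 : (Mc : ℤ) * a' i / (ρ : ℤ) = t i := by omega
    simp only [cornerP, gridFloor, h3]
  have hcorner0 : ∀ i, cornerP P Mc ρ a i = (ρ : ℤ) * q i := fun i => by simp only [cornerP, gridFloor, hq]
  -- the side is `ρ·s`, `s ≥ 1`
  obtain ⟨s, hs1, hside⟩ : ∃ s : ℕ, 1 ≤ s ∧ sideP P Mc ρ = ρ * s := ⟨(Mc + 11 * P.d) / ρ + 2, le_add_left (by norm_num), rfl⟩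
  refine ⟨a', box_subset_box_succ_of_corner P.L (fun i => ?_) (fun i => ?_) n⟩
  · -- `L·ρt ≤ ρq` from `L·⌊q/L⌋ ≤ q`
    rw [hcorner, hcorner0]
    have := Int.ediv_mul_le (q i) hL0.ne'
    simp only [ht]
    nlinarith
  · -- `ρq + ρs ≤ L(ρt + ρs)` from `q < L(⌊q/L⌋ + 1)` and `(L − 1)(s − 1) ≥ 0`
    rw [hcorner, hcorner0, hside]
    push_cast
    have h1 := Int.lt_ediv_add_one_mul_self (q i) hL0
    simp only [ht]
    have hs1' : (1 : ℤ) ≤ s := by exact_mod_cast hs1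
    have hL1 : (1 : ℤ) ≤ P.L := by exact_mod_cast hL
    have hq1 : q i + 1 ≤ (q i / (P.L : ℤ) + 1) * (P.L : ℤ) := h1
    nlinarith [mul_nonneg (sub_nonneg.mpr hL1) (sub_nonneg.mpr hs1'), hρ0.le]

/-- **THE GRID CUBE LIES IN ITS PRINT BOX** (`□ ⊆ 𝔔`; 36a's `cubeExt_subset_box_propCubeP` with only `0 < ρ` asked). [cite: Balaban1985Variational, (144) p.300; Balaban1985RegularSpaces, p.98] -/
theorem cubeExt_side_subset_box_cornerP (Mc : ℕ) {ρ : ℕ} (hρ : 0 < ρ) (a : Pt P.d) (n : ℕ) :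
    cubeExt (side P.L Mc n) a 0 ⊆ box P.L (cornerP P Mc ρ a) (sideP P Mc ρ) n := by
  rw [cubeExt_side_eq_box]
  refine box_subset_box_of_corner P.L (fun i => gridFloor_le hρ _) (fun i => ?_) n
  have h1 := lt_gridFloor_add hρ ((Mc : ℤ) * a i)
  have h2 : ((Mc + 11 * P.d + ρ + 1 : ℕ) : ℤ) ≤ ((sideP P Mc ρ : ℕ) : ℤ) := by exact_mod_cast le_sideP (P := P) Mc hρ
  have hd : (0 : ℤ) ≤ (P.d : ℤ) := by positivity
  show (Mc : ℤ) * a i + (Mc : ℤ) ≤ gridFloor ρ ((Mc : ℤ) * a i) + ((sideP P Mc ρ : ℕ) : ℤ)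
  push_cast at h2
  linarith

end Boxes

/-! ## §4  The reduction: all datums from the clean datums -/

section Reduction

variable {P : Params} {N : ℕ}

/-- ★★★ **ALL DATUMS FROM THE CLEAN DATUMS** (generic torus `P`, any region sequence `Ω`, any field `U`): if the split clause holds at every datum `(j, a)`, `1 ≤ j ≤ k`,
whose print box comes within `3` of `Ω_j` AND is CLEAN (`j = k`, or the box carries no point of `Ω_{j+1}` — print's «□ intersecting Ω_j but not Ω_{j+1}»), and every
inward level-`j` print box lies in a level-`(j+1)` print box, then the clause holds at EVERY datum whose box comes within `3` of `Ω_j` (induction on `k − j`; §2 `.raise`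
with `ε_{j+1} ≤ 2ε_j`, `δ_{j+1} ≤ 2δ_j`, `L ≥ 2`). [cite: Balaban1985Variational, p.279 (class of cubes), p.300, (147)–(150) p.301, (160) p.303, (165)–(168) p.304] -/
theorem localGaugeSplitOn_allDatums_of_clean (hL : 2 ≤ P.L) {Mc ρ : ℕ} (Ω : ℕ → Set (Site P 0)) (k : ℕ) (ε δ : ℕ → ℝ)
    {κ C θ Q : ℝ} (hκ : 0 ≤ κ) (hC : 0 ≤ C) (hθ : 0 ≤ θ) (hQ : 0 ≤ Q)
    (hε0 : ∀ n, n ≤ k → 0 ≤ ε n) (hδ0 : ∀ n, n ≤ k → 0 ≤ δ n)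
    (hεcomp' : ∀ n, n < k → ε (n + 1) ≤ 2 * ε n) (hδcomp' : ∀ n, n < k → δ (n + 1) ≤ 2 * δ n)
    (U : GaugeField P 0 (SU N))
    (hnest : ∀ j, 1 ≤ j → j < k → ∀ a : Pt P.d, (∃ z ∈ box P.L (cornerP P Mc ρ a) (sideP P Mc ρ) j, cover P z ∈ Ω (j + 1)) →
      ∃ a' : Pt P.d, box P.L (cornerP P Mc ρ a) (sideP P Mc ρ) j ⊆ box P.L (cornerP P Mc ρ a') (sideP P Mc ρ) (j + 1))
    (hclean : ∀ j, 1 ≤ j → j ≤ k → ∀ a : Pt P.d,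
      (∃ x ∈ box P.L (cornerP P Mc ρ a) (sideP P Mc ρ) j, ∃ y : Pt P.d, cover P y ∈ Ω j ∧ Within ((3 : ℕ) : ℤ) x y) →
      (j = k ∨ ∀ z ∈ box P.L (cornerP P Mc ρ a) (sideP P Mc ρ) j, cover P z ∉ Ω (j + 1)) →
      LocalGaugeSplitOn (cover P '' box P.L (cornerP P Mc ρ a) (sideP P Mc ρ) j) (P.eta j) (κ * ε j) (C * δ j + θ * ε j + Q * ε j ^ 2) U) :
    ∀ j, 1 ≤ j → j ≤ k → ∀ a : Pt P.d,
      (∃ x ∈ box P.L (cornerP P Mc ρ a) (sideP P Mc ρ) j, ∃ y : Pt P.d, cover P y ∈ Ω j ∧ Within ((3 : ℕ) : ℤ) x y) →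
      LocalGaugeSplitOn (cover P '' box P.L (cornerP P Mc ρ a) (sideP P Mc ρ) j) (P.eta j) (κ * ε j) (C * δ j + θ * ε j + Q * ε j ^ 2) U := by
  -- induction on the co-level `r = k − j`
  suffices H : ∀ r j, k - j = r → 1 ≤ j → j ≤ k → ∀ a : Pt P.d,
      (∃ x ∈ box P.L (cornerP P Mc ρ a) (sideP P Mc ρ) j, ∃ y : Pt P.d, cover P y ∈ Ω j ∧ Within ((3 : ℕ) : ℤ) x y) →
      LocalGaugeSplitOn (cover P '' box P.L (cornerP P Mc ρ a) (sideP P Mc ρ) j) (P.eta j) (κ * ε j) (C * δ j + θ * ε j + Q * ε j ^ 2) U from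
    fun j hj hjk a hmeet => H (k - j) j rfl hj hjk a hmeet
  intro r
  induction r with
  | zero =>
      intro j hr hj hjk a hmeet
      exact hclean j hj hjk a hmeet (Or.inl (by omega))
  | succ r ih =>
      intro j hr hj hjk a hmeet
      by_cases hin : ∃ z ∈ box P.L (cornerP P Mc ρ a) (sideP P Mc ρ) j, cover P z ∈ Ω (j + 1)
      · -- inward datum: raise the level
        have hjk' : j < k := by omega
        obtain ⟨a', hsub⟩ := hnest j hj hjk' a hin
        obtain ⟨z, hz, hzΩ⟩ := hin
        have hmeet' : ∃ x ∈ box P.L (cornerP P Mc ρ a') (sideP P Mc ρ) (j + 1), ∃ y : Pt P.d, cover P y ∈ Ω (j + 1) ∧ Within ((3 : ℕ) : ℤ) x y :=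
          ⟨z, hsub hz, z, hzΩ, Within.refl (by norm_num) z⟩
        have hup := ih (j + 1) (by omega) (by omega) (by omega) a' hmeet'
        exact hup.raise (Set.image_mono hsub) hL j hκ hC hθ hQ (hε0 j hjk) (hδ0 j hjk) (hε0 (j + 1) (by omega)) (hεcomp' j hjk') (hδcomp' j hjk')
      · -- clean datum
        push Not at hin
        exact hclean j hj hjk a hmeet (Or.inr hin)

/-- ★★★ **THE GUARDED PER-DATUM TOKEN FROM ITS CLEAN-DATUM RESTRICTION** — print's «□ intersecting Ω_j but NOT Ω_{j+1}» for the tree's grid datums: dag-n07-w4's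
`DatumGaugeSplitTopStepCoreG F N Sup Mc ρ Adm B₃ C θ Q κ a₀ a₁` (⇒ `LocalLettersSplitTopStepCoreG` ⇒ `HalvingStepTopCoreG` ⇒ Core⇒Top ⇒ `Prop8RegSepTopStepG` ⇒ stub 1) holds as
soon as the SAME clause is supplied under the SAME prefix at the datums whose print box comes within `3` of `Ω_j` (box form) AND is CLEAN: `j = k ∨ 𝔔(j,a) ∩ π⁻¹Ω_{j+1} = ∅`.
Side letters `1 ≤ Mc ≤ ρ` (§3), `0 ≤ B₃ κ C θ Q` (§2); `2 ≤ L` is `F.hL11`.  The head's knit owes `hP6 ∕ HCHART ∕ HBUDGET` only at clean datums (windows over `{j−1, j}`).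
[cite: Balaban1985Variational, p.279 (class of cubes), (144) p.300, p.300 («□ intersecting Ω_j but not Ω_{j+1}»), (147)–(150) p.301, (160) p.303, (165)–(168) p.304, Prop. 8 p.304] -/
theorem datumGaugeSplitTopStepCoreG_of_clean (F : T4Family) (N : ℕ) [NeZero N]
    {Sup : (ν : Stage7Numerics) → (K : ℕ) → (ℕ → Set (Site (F.P K) 0)) → Set (Site (F.P K) 0)} {Mc ρ : ℕ} (hMc : 1 ≤ Mc) (hMcρ : Mc ≤ ρ)
    {Adm : StepGuard F} {B₃ C θ Q κ a₀ a₁ : ℝ} (hB₃ : 0 ≤ B₃) (hκ : 0 ≤ κ) (hC : 0 ≤ C) (hθ : 0 ≤ θ) (hQ : 0 ≤ Q)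
    (h : ∀ (ν : Stage7Numerics) (M : ℕ) (g : ℕ → ℝ) (K k : ℕ) (s : SeqOfRecord F ν M g K k), Sect2.SeqSeparated ν.M₁ s → 0 < ν.M₁ → Adm ν M g K k s → 1 ≤ k →
      ∀ (ε δ : ℕ → ℝ),
      (∀ n, n ≤ k → 0 < δ n ∧ δ n ≤ a₁) → (∀ n, n < k → δ n ≤ 2 * δ (n + 1)) → (∀ n, n < k → δ (n + 1) ≤ 2 * δ n) →
      (∀ n, n ≤ k → B₃ * δ n ≤ ε n ∧ ε n ≤ a₀) → (∀ n, n < k → ε n ≤ 2 * ε (n + 1)) → (∀ n, n < k → ε (n + 1) ≤ 2 * ε n) →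
      ∀ W : MSField (F.P K) (SU N), Sect2.DataSmall7PTop (avOfRecord F N K) s.Ω (Sup ν K s.Ω) k δ W →
        ∀ U : GaugeField (F.P K) 0 (SU N),
          (∀ n, n ≤ k → PlaqSmallOn (Sect2.omegaPlaqsTop s.Ω (Sup ν K s.Ω) n) (ε n * (F.P K).eta n ^ 2) U) →
          (∀ n, n ≤ k → Sect2.CoDivSmallOn (Sect2.omegaBondsTop s.Ω (Sup ν K s.Ω) n) (ε n * (F.P K).eta n ^ 3) U) →
          AgreeOn (genSet s.Ω k) (avgFamily (avOfRecord F N K) U) W →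
          IsCritOnFibre F N K (genSet s.Ω k) W U →
          ∀ j, 1 ≤ j → j ≤ k → ∀ a : Pt (F.P K).d,
            (∃ x ∈ box (F.P K).L (cornerP (F.P K) Mc ρ a) (sideP (F.P K) Mc ρ) j, ∃ y : Pt (F.P K).d, cover (F.P K) y ∈ s.Ω j ∧ Within ((3 : ℕ) : ℤ) x y) →
            (j = k ∨ ∀ z ∈ box (F.P K).L (cornerP (F.P K) Mc ρ a) (sideP (F.P K) Mc ρ) j, cover (F.P K) z ∉ s.Ω (j + 1)) →
            LocalGaugeSplitOn (cover (F.P K) '' box (F.P K).L (cornerP (F.P K) Mc ρ a) (sideP (F.P K) Mc ρ) j)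
              ((F.P K).eta j) (κ * ε j) (C * δ j + θ * ε j + Q * ε j ^ 2) U) :
    DatumGaugeSplitTopStepCoreG F N Sup Mc ρ Adm B₃ C θ Q κ a₀ a₁ := by
  intro ν M g K k s hsep hM₁ hadm hk ε δ hδ hcompδ hcompδ' hε hεcomp hεcomp' W h7 U h17 h19 hfib hcrit j hj hjk a hmeet
  have hL2 : 2 ≤ (F.P K).L := by have := F.hL11; rw [T4Family.P_L]; omega
  have hL1 : 1 ≤ (F.P K).L := le_trans (by norm_num) hL2
  have hρ0 : 0 < ρ := lt_of_lt_of_le hMc hMcρ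
  have hδ0 : ∀ n, n ≤ k → 0 ≤ δ n := fun n hn => (hδ n hn).1.le
  have hε0 : ∀ n, n ≤ k → 0 ≤ ε n := fun n hn => le_trans (mul_nonneg hB₃ (hδ0 n hn)) (hε n hn).1
  -- the token's meeting premise (grid cube within 3 of `Ω_j`) gives the box premise (`□ ⊆ 𝔔`)
  have hmeet' : ∃ x ∈ box (F.P K).L (cornerP (F.P K) Mc ρ a) (sideP (F.P K) Mc ρ) j, ∃ y : Pt (F.P K).d,
      cover (F.P K) y ∈ s.Ω j ∧ Within ((3 : ℕ) : ℤ) x y := by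
    obtain ⟨x, y, hx, hy, hw⟩ := hmeet
    exact ⟨x, cubeExt_side_subset_box_cornerP Mc hρ0 a j hx, y, hy, hw⟩
  exact localGaugeSplitOn_allDatums_of_clean hL2 s.Ω k ε δ hκ hC hθ hQ hε0 hδ0 hεcomp' hcompδ' U
    (fun j' hj' hjk' a' _ => exists_cornerP_box_subset_succ hMc hMcρ hL1 a' j')
    (h ν M g K k s hsep hM₁ hadm hk ε δ hδ hcompδ hcompδ' hε hεcomp hεcomp' W h7 U h17 h19 hfib hcrit) j hj hjk a hmeet'

end Reduction

end Summit.QuantumFields.YangMills.BalabanUVNodes.N07SplitClauseLevelRaising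
end
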